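import Summits.FinalStateConjecture.FinalStateConjecture.Theorems.PhaseMixingCaptureWeakCosmicCensorshipMGHDStubFarSojournTransfer
import Literature.Geometry.Lorentzian.KerrData
import HarnessLib

/-!
# `NearExtremalKappaCapture`, line `unit-temperature-front-face` — stub F2
# `stub_kerrSlabFarSojournTransfer`: the flat-leaf chart optics transport into realised developments

Support file for crux `stmt-FinalStateConjecture-10606`
(`Summit.FinalStateConjecture.FinalStateConjecture.Theses.PhaseMixingCapture.NearExtremalKappaCapture`): the
registered stub `stub_kerrSlabFarSojournTransfer`.  For `0 < M`, `|a| < M`, a future unit normal field `ν` of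
the flat slice embedding `Kerr.sliceEmbed a M : y ↦ (0, y)`, a vacuum Cauchy development `𝒦` of the exact Kerr
datum `Kerr.data M a M` and a smooth, time-orientation preserving, isometric open embedding
`j : 𝒦 → Kerr.region a M` over the slice (`j ∘ ι_𝒦 = sliceEmbed a M`, `dj ν_𝒦 = ν`) whose range contains the
half-chart `{t* ≥ 0}`: granted the sojourn optics of the chart seen from the flat leaf (the conclusion of the
sibling stub `stub_kerrFlatLeafOptics`, taken as a hypothesis), for every `s > 0` there is `R₁` such that every
normalised future null ray of `𝒦` from a slice point of Kerr–Schild radius `≥ R₁` is future complete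
(`¬ BddAbove dom`) or sojourns affine time `≥ s` in `J⁺_𝒦(ι_𝒦{8M ≤ ‖y′‖ ≤ 10M})`.

This is the flat-leaf port of the landed bent-leaf transfer
`PhaseMixingCapture.WeakCosmicCensorshipMGHD.stub_farSojournTransfer` (plumbing over the same three engines:
maximal `𝒦`-rays are lifts of maximal chart rays, `exists_isMaximalGeodesicOn_lift` and
`IsMaximalGeodesicOn.mem_of_forall_exists_lift`; chart causal curves inside `range j` pull back along `j⁻¹`,
`LorentzianMetric.invFun_mem_causalFuture`).  The only change is the clock: instead of the bent collar clock
`u = t* − T(r)` we use the chart time `t*` itself, which is non-decreasing along future causal chart curves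
(`KerrSlabTransfer.monotoneOn_time`: future causal chart vectors have `v⁰ ≥ |v⃗| ≥ 0`), so a future causal
chart curve issuing from the flat leaf `{t* = 0}` stays in `{t* ≥ 0} ⊆ range j`
(`KerrSlabTransfer.time_nonneg_of_le`).  Positivity of the Killing energy of the chart ray (needed for
`KerrLeafSojourn.ray_isFutureCausalCurveOn`) comes from the pinch `(1 − 4H) v⁰ ≤ E` with `H ≤ 1/16` at the far
leaf point (`KerrLeafSojourn.energy_pinch`, `KerrLeafSojourn.far_leaf_numerics`).

References: D. Christodoulou, CQG 16 (1999) A23, pp. A26–A27; M. Dafermos, I. Rodnianski, arXiv:0811.0354,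
§5.1; B. O'Neill, *Semi-Riemannian geometry* (1983), Ch. 3, Prop. 3.24 and pp. 90–91, Ch. 14, pp. 402, 415.
-/

-- lint debt: the summit and the problem are both named `FinalStateConjecture` (tree layout)
set_option linter.dupNamespace false

noncomputable section

open scoped Manifold ContDiff Topology
open Set Function Filter Topology Literature.Geometry.Lorentzian
open Summit.FinalStateConjecture.FinalStateConjecture.Theorems.PhaseMixingCapture.WeakCosmicCensorshipMGHD
  (exists_isMaximalGeodesicOn_lift)
open Summit.FinalStateConjecture.FinalStateConjecture.Theorems.SwallowTheDatum.KerrShieldedSettles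
  (CollarCauchy.velocity_eq_deriv ScriTransport.causalCurve_velocity
    KerrLeafSojourn.ray_isFutureCausalCurveOn KerrLeafSojourn.energy_pinch KerrLeafSojourn.far_leaf_numerics
    KerrLeafSojourn.monotoneOn_time_coord KerrLeafSojourn.norm_spatial_le_of_causal)

namespace Summit.FinalStateConjecture.FinalStateConjecture.Theorems.NearExtremalKappaCapture.UnitTemperatureFrontFace

/-! ## The chart time `t*` along future causal curves of the Kerr chart -/

namespace KerrSlabTransfer

variable [Kerr.Facts] {M a r₁ : ℝ} {hM : 0 ≤ M} {γ : ℝ → Kerr.region a r₁} {s : Set ℝ}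

/-- **`t*` is non-decreasing along future causal curves of the Kerr chart** (`M ≥ 0`) on an interval: the
chart velocity `v` of such a curve is causal with `g(V, v) = −v⁰ < 0` (`ScriTransport.causalCurve_velocity`,
`Kerr.bilin_timeVector`), hence obeys the speed limit `|v⃗| ≤ v⁰` (`KerrLeafSojourn.norm_spatial_le_of_causal`),
and `KerrLeafSojourn.monotoneOn_time_coord` (mean value theorem) applies. O'Neill 1983, Ch. 14, p. 415.
[cite: ONeillSemiRiemannian1983, Ch. 14, Def. 14.28 (p. 415)] -/
theorem monotoneOn_time (hs : s.OrdConnected)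
    (hγ : (Kerr.smoothMetric M a r₁).IsFutureCausalCurveOn
      ((Kerr.timeOrientation M a r₁ hM).ofLE le_top) γ s) :
    MonotoneOn (fun σ ↦ (γ σ : E4) 0) s := by
  refine KerrLeafSojourn.monotoneOn_time_coord (c := fun σ ↦ (γ σ : E4))
    (v := fun t ↦ deriv (fun σ ↦ (γ σ : E4)) t) hs
    (fun t ht ↦ (ScriTransport.causalCurve_velocity hγ ht).1) fun t ht ↦ ?_
  obtain ⟨-, hc, -, hfd⟩ := ScriTransport.causalCurve_velocity hγ ht
  have hx : 0 < Kerr.radius a (γ t) := Kerr.radius_pos_of_mem_region (γ t).2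
  rw [Kerr.bilin_timeVector hx] at hfd
  exact KerrLeafSojourn.norm_spatial_le_of_causal hM a _ hc (by linarith)

/-- **Future causal chart curves issuing from `{t* ≥ 0}` stay in `{t* ≥ 0}`** (monotone chart time,
`monotoneOn_time`). In particular every future causal curve on an interval which starts on the flat leaf
`{t* = 0}` lies in the half-chart `{t* ≥ 0}`. O'Neill 1983, Ch. 14, p. 415.
[cite: ONeillSemiRiemannian1983, Ch. 14, Def. 14.28 (p. 415)] -/
theorem time_nonneg_of_le (hs : s.OrdConnected)
    (hγ : (Kerr.smoothMetric M a r₁).IsFutureCausalCurveOn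
      ((Kerr.timeOrientation M a r₁ hM).ofLE le_top) γ s)
    {t₀ : ℝ} (h₀ : t₀ ∈ s) (hu₀ : 0 ≤ (γ t₀ : E4) 0) {t : ℝ} (ht : t ∈ s) (h₀t : t₀ ≤ t) :
    0 ≤ (γ t : E4) 0 :=
  hu₀.trans (monotoneOn_time hs hγ h₀ ht h₀t)

end KerrSlabTransfer

/-! ## The registered stub -/

/-- **Stub F2 `stub_kerrSlabFarSojournTransfer` — the chart optics transport into any vacuum Cauchy
development of the exact Kerr datum realised in the chart over the flat leaf** (line
`unit-temperature-front-face` of crux `stmt-FinalStateConjecture-10606`; plumbing adapter).  For `0 < M`,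
`|a| < M`, a future unit normal field `ν` of `Kerr.sliceEmbed a M`, a vacuum Cauchy development `𝒦` of
`Kerr.data M a M` and a smooth, time-orientation preserving, isometric open embedding `j : 𝒦 → Kerr.region a M`
over the slice (`j ∘ ι_𝒦 = sliceEmbed a M`, `dj ν_𝒦 = ν`) whose range contains the half-chart `{t* ≥ 0}`:
granted the flat-leaf optics of the chart (hypothesis), for every `s > 0` there is `R₁` (the optics threshold
enlarged to `max R₁ (16M + |a| + 1)`) such that every normalised future null ray of `𝒦` from a slice point of
radius `≥ R₁` is future complete (`¬ BddAbove dom`) or sojourns affine time `≥ s` in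
`J⁺_𝒦(ι_𝒦{8M ≤ ‖y′‖ ≤ 10M})`.  Proof.  A maximal normalised `𝒦`-ray `γ : dom` from `ι_𝒦 y` has push-forward
data `((0, y), L = dj γ̇(0))`, null, future-directed and normalised (`j` isometric and time-orientation
preserving, `dj ν_𝒦 = ν`); the maximal chart geodesic `γ_K : dom_K` with these data is a normalised null ray of
the chart from `y`, and its maximal lift through `ι_𝒦 y` (`exists_isMaximalGeodesicOn_lift`) is `γ` itself
(uniqueness of maximal geodesics, O'Neill 1983, Ch. 3, Prop. 3.24), so `j ∘ γ = γ_K` on `dom ⊆ dom_K`.  The chart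
ray is a future causal curve (Killing energy `E ≥ (1 − 4H) γ̇⁰_K(0) > 0` at the far leaf point, `H ≤ 1/16`,
`KerrLeafSojourn.ray_isFutureCausalCurveOn`) issuing from the flat leaf `{t* = 0}`, so its chart time stays
`≥ 0` (`KerrSlabTransfer.time_nonneg_of_le`), inside `range j`; hence `[0, ∞) ∩ dom_K ⊆ dom`
(`IsMaximalGeodesicOn.mem_of_forall_exists_lift`), and chart completeness `[0, ∞) ⊆ dom_K` gives
`¬ BddAbove dom`.  For the sojourn, a chart causal curve from `(0, y')` to `γ_K t` stays in `{t* ≥ 0}` (same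
clock) and pulls back along `j⁻¹` to a causal curve of `𝒦` from `ι_𝒦 y'` to `γ t`
(`LorentzianMetric.invFun_mem_causalFuture`; `j` is a local diffeomorphism by the inverse function theorem,
`LorentzianMetric.isLocalDiffeomorph_of_isIsometricImmersion`), so the chart sojourn set of `γ_K` is contained in
that of `γ` and `measure_mono` concludes.  Christodoulou, CQG 16 (1999) A23, pp. A26–A27; O'Neill 1983, Ch. 3,
Prop. 3.24 and pp. 90–91, Ch. 14, p. 402. [cite: ONeillSemiRiemannian1983, Ch. 3, Prop. 24] -/
theorem stub_kerrSlabFarSojournTransfer : ∀ [Kerr.Facts] [Kerr.SliceFacts] (M a : ℝ) (hM : 0 < M), |a| < M →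
    ∀ (ν : NormalField 𝓘(ℝ, E4) (Kerr.sliceEmbed a M)),
    (Kerr.smoothMetric M a M).IsFutureUnitNormal 𝓘(ℝ, E3)
        ((Kerr.timeOrientation M a M hM.le).ofLE le_top) (Kerr.sliceEmbed a M) ν →
    ∀ (𝒦 : VacuumCauchyDevelopment (Kerr.data M a M hM.le)) (j : 𝒦.carrier → Kerr.region a M),
    (ContMDiff (𝓡 4) 𝓘(ℝ, E4) ∞ j ∧ Topology.IsOpenEmbedding j ∧
      𝒦.metric.IsIsometricImmersion (Kerr.smoothMetric M a M).toPseudoRiemannianMetric j ∧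
      𝒦.timeOrientation.PreservesTimeOrientation j ((Kerr.timeOrientation M a M hM.le).ofLE le_top) ∧
      j ∘ 𝒦.embed = Kerr.sliceEmbed a M ∧
      (∀ y : Kerr.slice a M, mfderiv (𝓡 4) 𝓘(ℝ, E4) j (𝒦.embed y) (𝒦.normal y) = ν y) ∧
      {x : Kerr.region a M | 0 ≤ (x : E4) 0} ⊆ Set.range j) →
    (∀ [(Kerr.smoothMetric M a M).HasLeviCivita], ∀ s : ℝ, 0 < s → ∃ R₁ : ℝ, ∀ y : Kerr.slice a M,
      R₁ ≤ Kerr.radius a (E4.ofTimeSpace 0 (y : E3)) →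
      ∀ (γ : ℝ → Kerr.region a M) (dom : Set ℝ),
        (Kerr.smoothMetric M a M).IsNormalisedNullRayFrom
            ((Kerr.timeOrientation M a M hM.le).ofLE le_top) (Kerr.sliceEmbed a M) ν y γ dom →
        Set.Ici (0 : ℝ) ⊆ dom ∨
          ENNReal.ofReal s ≤ sojournTime γ dom
            ((Kerr.smoothMetric M a M).causalFuture ((Kerr.timeOrientation M a M hM.le).ofLE le_top)
              (Kerr.sliceEmbed a M ''
                {y' : Kerr.slice a M | 8 * M ≤ ‖(y' : E3)‖ ∧ ‖(y' : E3)‖ ≤ 10 * M}))) →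
    ∀ [𝒦.metric.HasLeviCivita], ∀ s : ℝ, 0 < s → ∃ R₁ : ℝ, ∀ y : Kerr.slice a M,
      R₁ ≤ Kerr.radius a (E4.ofTimeSpace 0 (y : E3)) → ∀ (γ : ℝ → 𝒦.carrier) (dom : Set ℝ),
      𝒦.metric.IsNormalisedNullRayFrom 𝒦.timeOrientation 𝒦.embed 𝒦.normal y γ dom →
      ¬ BddAbove dom ∨ ENNReal.ofReal s ≤ sojournTime γ dom
        (𝒦.metric.causalFuture 𝒦.timeOrientation
          (𝒦.embed '' {y' : Kerr.slice a M | 8 * M ≤ ‖(y' : E3)‖ ∧ ‖(y' : E3)‖ ≤ 10 * M})) := by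
  -- adapted from `PhaseMixingCapture.WeakCosmicCensorshipMGHD.stub_farSojournTransfer` (bent leaf)
  intro _ _ M a hM ha ν _hν 𝒦 j hreal H inst𝒦 s hs
  obtain ⟨hjs, hjo, hiso, hτ, hjι, hjν, hW⟩ := hreal
  -- both Levi-Civita connections are `C¹`
  have h2 : ((1 : ℕ∞) : ℕ∞ω) + 1 ≤ ∞ := by
    rw [show ((1 : ℕ∞) : ℕ∞ω) + 1 = 2 by norm_num]; exact WithTop.coe_le_coe.2 le_top
  haveI : CovariantDerivative.ContMDiffCovariantDerivative
      (Kerr.smoothMetric M a M).toPseudoRiemannianMetric.leviCivita 1 :=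
    ⟨(Kerr.smoothMetric M a M).toPseudoRiemannianMetric.isLocallyContMDiff_leviCivita_holds 1 h2
      univ isOpen_univ⟩
  haveI : CovariantDerivative.ContMDiffCovariantDerivative
      𝒦.metric.toPseudoRiemannianMetric.leviCivita 1 :=
    ⟨𝒦.metric.toPseudoRiemannianMetric.isLocallyContMDiff_leviCivita_holds 1 h2 univ isOpen_univ⟩
  -- `dj` preserves scalar products, hence is injective; `j` is an injective local diffeomorphism
  have hval : ∀ (x : 𝒦.carrier) (u u' : TangentSpace (𝓡 4) x), 𝒦.metric.val x u u' =
      (Kerr.smoothMetric M a M).val (j x) (mfderiv (𝓡 4) 𝓘(ℝ, E4) j x u)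
        (mfderiv (𝓡 4) 𝓘(ℝ, E4) j x u') :=
    fun x u u' ↦ by
      have h := congrArg (fun b ↦ b u u') (hiso.2 x)
      simpa only [pullbackBilin_apply] using h.symm
  have hj' : ∀ x, Injective (mfderiv (𝓡 4) 𝓘(ℝ, E4) j x) := fun x ↦ by
    refine (injective_iff_map_eq_zero _).2 fun u hu ↦ 𝒦.metric.nondegenerate x u fun u' ↦ ?_
    rw [hval, hu, map_zero]
    rfl
  have hdim : Module.finrank ℝ (EuclideanSpace ℝ (Fin 4)) = Module.finrank ℝ E4 := rfl
  have hj1 : ContMDiff (𝓡 4) 𝓘(ℝ, E4) (∞ + 1) j := hjs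
  have hjinj : Injective j := hjo.injective
  have hloc : IsLocalDiffeomorph (𝓡 4) 𝓘(ℝ, E4) ∞ j :=
    LorentzianMetric.isLocalDiffeomorph_of_isIsometricImmersion hiso
  -- the optics of the chart, used at the far radius `max R₁ (16M + |a| + 1)`
  obtain ⟨R₁, hR₁⟩ := H s hs
  refine ⟨max R₁ (16 * M + |a| + 1), fun y hy γ dom hγ ↦ ?_⟩
  haveI : Nonempty 𝒦.carrier := ⟨𝒦.embed y⟩
  have hyR₁ : R₁ ≤ Kerr.radius a (E4.ofTimeSpace 0 (y : E3)) := (le_max_left _ _).trans hy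
  have hy16 : 16 * M + |a| + 1 ≤ ‖(y : E3)‖ :=
    ((le_max_right _ _).trans hy).trans
      ((Kerr.radius_le_spatialNorm a _).trans_eq (E4.spatialNorm_ofTimeSpace 0 _))
  -- data of the `𝒦`-ray
  have hmax := hγ.isMaximalGeodesicOn
  have hγ0 : γ 0 = 𝒦.embed y := hγ.apply_zero
  have hjy : j (𝒦.embed y) = Kerr.sliceEmbed a M y := congrFun hjι y
  -- the maximal chart geodesic with data `((0, y), dj γ̇(0))`; its maximal lift is `γ` itself
  obtain ⟨γK, domK, hKmax, h0K, hK0, hKv, -⟩ :=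
    exists_isMaximalGeodesicOn
      (cov := (Kerr.smoothMetric M a M).toPseudoRiemannianMetric.leviCivita) (Kerr.sliceEmbed a M y)
      (mfderiv (𝓡 4) 𝓘(ℝ, E4) j (𝒦.embed y) (velocity (𝓡 4) γ 0))
  have hq : j (𝒦.embed y) = γK 0 := hjy.trans hK0.symm
  obtain ⟨γ', dom', hmax', h0', hγ'0, hγ'v, hdom', hagree'⟩ :=
    exists_isMaximalGeodesicOn_lift (g := (Kerr.smoothMetric M a M).toPseudoRiemannianMetric)
      (g' := 𝒦.metric.toPseudoRiemannianMetric) hj1 hj' hdim hiso.2 hKmax h0K hq hKv.symm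
  obtain ⟨Γ, S, hΓmax, -, -, -, hΓr⟩ :=
    exists_isMaximalGeodesicOn (cov := 𝒦.metric.toPseudoRiemannianMetric.leviCivita) (𝒦.embed y)
      (velocity (𝓡 4) γ 0)
  obtain ⟨hdomS, hγΓ⟩ := hΓr γ dom hmax.isOpen hmax.2.1 hγ.zero_mem hmax.isGeodesicOn hγ0 rfl
  have hSdom : S = dom := hmax.2.2.2 Γ S hΓmax.isOpen hΓmax.2.1 hdomS hΓmax.isGeodesicOn hγΓ
  obtain ⟨hdom'S, hγ'Γ⟩ := hΓr γ' dom' hmax'.isOpen hmax'.2.1 h0' hmax'.isGeodesicOn hγ'0 hγ'v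
  have hSdom' : S = dom' := hmax'.2.2.2 Γ S hΓmax.isOpen hΓmax.2.1 hdom'S hΓmax.isGeodesicOn hγ'Γ
  have hdd : dom = dom' := hSdom.symm.trans hSdom'
  have hagree : ∀ t ∈ dom, j (γ t) = γK t := fun t ht ↦ by
    rw [hγΓ ht, ← hγ'Γ (hdd ▸ ht)]
    exact hagree' t (hdd ▸ ht)
  -- the push-forward data are null, future-directed and normalised
  have hLnull : Kerr.bilin M a (Kerr.sliceEmbed a M y)
      (mfderiv (𝓡 4) 𝓘(ℝ, E4) j (𝒦.embed y) (velocity (𝓡 4) γ 0))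
      (mfderiv (𝓡 4) 𝓘(ℝ, E4) j (𝒦.embed y) (velocity (𝓡 4) γ 0)) = 0 := by
    have h0 : (Kerr.smoothMetric M a M).val (j (𝒦.embed y))
        (mfderiv (𝓡 4) 𝓘(ℝ, E4) j (𝒦.embed y) (velocity (𝓡 4) γ 0))
        (mfderiv (𝓡 4) 𝓘(ℝ, E4) j (𝒦.embed y) (velocity (𝓡 4) γ 0)) = 0 := by
      rw [← hval]
      have key : ∀ (x : 𝒦.carrier) (_ : x = γ 0), 𝒦.metric.val x
          (show TangentSpace (𝓡 4) x from velocity (𝓡 4) γ 0)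
          (show TangentSpace (𝓡 4) x from velocity (𝓡 4) γ 0) = 0 := by
        rintro x rfl
        exact hγ.isNull_velocity.1
      exact key _ hγ0.symm
    have key : ∀ (p : Kerr.region a M) (_ : p = j (𝒦.embed y)), Kerr.bilin M a (p : E4)
        (mfderiv (𝓡 4) 𝓘(ℝ, E4) j (𝒦.embed y) (velocity (𝓡 4) γ 0))
        (mfderiv (𝓡 4) 𝓘(ℝ, E4) j (𝒦.embed y) (velocity (𝓡 4) γ 0)) = 0 := by
      rintro p rfl
      exact h0
    exact key _ hjy.symm
  have hLne : mfderiv (𝓡 4) 𝓘(ℝ, E4) j (𝒦.embed y) (velocity (𝓡 4) γ 0) ≠ 0 := by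
    intro h
    apply hγ.isNull_velocity.2
    apply hj' (𝒦.embed y)
    rw [h]
    exact (map_zero _).symm
  have hLfd : ((Kerr.timeOrientation M a M hM.le).ofLE le_top :
      TimeOrientation (Kerr.smoothMetric M a M)).IsFutureDirected (x := Kerr.sliceEmbed a M y)
      (mfderiv (𝓡 4) 𝓘(ℝ, E4) j (𝒦.embed y) (velocity (𝓡 4) γ 0)) := by
    have h1 : 𝒦.timeOrientation.IsFutureDirected (x := 𝒦.embed y) (velocity (𝓡 4) γ 0) := by
      have key : ∀ (x : 𝒦.carrier) (_ : x = γ 0), 𝒦.timeOrientation.IsFutureDirected (x := x)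
          (show TangentSpace (𝓡 4) x from velocity (𝓡 4) γ 0) := by
        rintro x rfl
        exact hγ.isFutureDirected_velocity
      exact key _ hγ0.symm
    have h2 := hτ.isFutureDirected_mfderiv hiso.2 h1
    have key : ∀ (p : Kerr.region a M) (_ : p = j (𝒦.embed y)),
        ((Kerr.timeOrientation M a M hM.le).ofLE le_top :
          TimeOrientation (Kerr.smoothMetric M a M)).IsFutureDirected (x := p)
          (show TangentSpace 𝓘(ℝ, E4) p from
            mfderiv (𝓡 4) 𝓘(ℝ, E4) j (𝒦.embed y) (velocity (𝓡 4) γ 0)) := by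
      rintro p rfl
      exact h2
    exact key _ hjy.symm
  have hLnorm : Kerr.bilin M a (Kerr.sliceEmbed a M y)
      (mfderiv (𝓡 4) 𝓘(ℝ, E4) j (𝒦.embed y) (velocity (𝓡 4) γ 0)) (ν y) = -1 := by
    have h0 : (Kerr.smoothMetric M a M).val (j (𝒦.embed y))
        (mfderiv (𝓡 4) 𝓘(ℝ, E4) j (𝒦.embed y) (velocity (𝓡 4) γ 0))
        (mfderiv (𝓡 4) 𝓘(ℝ, E4) j (𝒦.embed y) (𝒦.normal y)) = -1 := by
      rw [← hval]
      exact hγ.val_velocity_normal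
    have key : ∀ (p : Kerr.region a M) (_ : p = j (𝒦.embed y)), Kerr.bilin M a (p : E4)
        (mfderiv (𝓡 4) 𝓘(ℝ, E4) j (𝒦.embed y) (velocity (𝓡 4) γ 0))
        (mfderiv (𝓡 4) 𝓘(ℝ, E4) j (𝒦.embed y) (𝒦.normal y)) = -1 := by
      rintro p rfl
      exact h0
    have h1 := key _ hjy.symm
    rwa [hjν y] at h1
  -- so the chart geodesic is a normalised null ray from `y`, to which the optics apply
  have hrayK : (Kerr.smoothMetric M a M).IsNormalisedNullRayFrom
      ((Kerr.timeOrientation M a M hM.le).ofLE le_top) (Kerr.sliceEmbed a M) ν y γK domK := by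
    refine ⟨hKmax, h0K, hK0, ⟨?_, ?_⟩, ?_, ?_⟩
    · change Kerr.bilin M a (γK 0 : E4) (velocity 𝓘(ℝ, E4) γK 0) (velocity 𝓘(ℝ, E4) γK 0) = 0
      rw [hKv, hK0]
      exact hLnull
    · rw [hKv]; exact hLne
    · have key : ∀ (p : Kerr.region a M) (_ : p = Kerr.sliceEmbed a M y) (u : E4)
          (_ : u = mfderiv (𝓡 4) 𝓘(ℝ, E4) j (𝒦.embed y) (velocity (𝓡 4) γ 0)),
          ((Kerr.timeOrientation M a M hM.le).ofLE le_top :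
            TimeOrientation (Kerr.smoothMetric M a M)).IsFutureDirected (x := p)
            (show TangentSpace 𝓘(ℝ, E4) p from u) := by
        rintro p rfl u rfl
        exact hLfd
      exact key _ hK0 _ hKv
    · change Kerr.bilin M a (Kerr.sliceEmbed a M y : E4) (velocity 𝓘(ℝ, E4) γK 0) (ν y) = -1
      rw [hKv]
      exact hLnorm
  -- the chart ray is a future causal curve (energy `E ≥ (1 − 4H) γ̇⁰ > 0` at the far leaf point,
  -- `H ≤ 1/16`) issuing from the flat leaf, hence stays in `{t* ≥ 0} ⊆ range j` for `t ≥ 0`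
  have hKoc : domK.OrdConnected := hKmax.2.1
  have hv0K : (velocity 𝓘(ℝ, E4) γK 0 : E4) = deriv (fun σ ↦ (γK σ : E4)) 0 :=
    CollarCauchy.velocity_eq_deriv γK 0
  have hnullK : Kerr.bilin M a (γK 0) (deriv (fun σ ↦ (γK σ : E4)) 0)
      (deriv (fun σ ↦ (γK σ : E4)) 0) = 0 := by
    have h : Kerr.bilin M a (γK 0) (velocity 𝓘(ℝ, E4) γK 0) (velocity 𝓘(ℝ, E4) γK 0) = 0 :=
      hrayK.isNull_velocity.1
    rwa [hv0K] at h
  have hxK : 0 < Kerr.radius a (γK 0 : E4) := Kerr.radius_pos_of_mem_region (γK 0).2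
  have hfdK : 0 < deriv (fun σ ↦ (γK σ : E4)) 0 0 := by
    have h : Kerr.bilin M a (γK 0) (Kerr.timeVector M a (γK 0)) (velocity 𝓘(ℝ, E4) γK 0) < 0 :=
      hrayK.isFutureDirected_velocity.2
    rw [Kerr.bilin_timeVector hxK, hv0K] at h
    linarith
  have hHK : Kerr.scalarH M a (γK 0 : E4) ≤ 1 / 16 := by
    rw [hK0, Kerr.coe_sliceEmbed]
    exact (KerrLeafSojourn.far_leaf_numerics (M := M) ha hy16).2.1 0
  have hE : 0 < -Kerr.bilin M a (γK 0) (deriv (fun σ ↦ (γK σ : E4)) 0) (E4.basisVector 0) := by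
    have h1 := (KerrLeafSojourn.energy_pinch hM.le a hxK hnullK.le hfdK.le).1
    nlinarith
  have hE0 : Kerr.bilin M a (γK 0) (deriv (fun σ ↦ (γK σ : E4)) 0) (E4.basisVector 0) ≠ 0 := by
    intro h; rw [h] at hE; simp at hE
  have hKc : (Kerr.smoothMetric M a M).IsFutureCausalCurveOn
      ((Kerr.timeOrientation M a M hM.le).ofLE le_top) γK domK :=
    KerrLeafSojourn.ray_isFutureCausalCurveOn hM.le hKmax.isOpen hKoc hKmax.isGeodesicOn h0K hnullK
      hfdK hE0 subset_rfl
  have huK0 : 0 ≤ (γK 0 : E4) 0 := by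
    rw [hK0, Kerr.coe_sliceEmbed, E4.ofTimeSpace_apply_zero]
  have hKrange : ∀ t ∈ domK, 0 ≤ t → γK t ∈ range j := fun t ht ht0 ↦
    hW (KerrSlabTransfer.time_nonneg_of_le hKoc hKc h0K huK0 ht ht0)
  -- hence the forward piece of the chart ray lies in `dom`: local lifts exist everywhere
  have hcover : ∀ t ∈ domK, 0 ≤ t → t ∈ dom := fun t ht ht0 ↦ by
    rw [hdd]
    refine hmax'.mem_of_forall_exists_lift hjinj hKoc h0' hdom' hagree' (fun b hb hbr ↦ ?_) ht ht0
      fun t' ht' ↦ hKrange t' (hKoc.out h0K ht ⟨ht'.1, ht'.2⟩) ht'.1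
    obtain ⟨p, hp⟩ := hbr
    have h0b : (0 : ℝ) ∈ {u : ℝ | u + b ∈ domK} := by
      show 0 + b ∈ domK
      rw [zero_add]; exact hb
    have hq : j p = (fun u ↦ γK (u - (-b))) 0 := by
      show j p = γK (0 - (-b))
      rw [hp]; congr 1; ring
    have hw : mfderiv (𝓡 4) 𝓘(ℝ, E4) j p
        ((mfderivEquivOfInjective (I := 𝓘(ℝ, E4)) (I' := 𝓡 4) j p (hj' p) hdim).symm
          (show TangentSpace 𝓘(ℝ, E4) (j p) from velocity 𝓘(ℝ, E4) (fun u ↦ γK (u - (-b))) 0)) =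
        velocity 𝓘(ℝ, E4) (fun u ↦ γK (u - (-b))) 0 :=
      mfderiv_mfderivEquivOfInjective_symm j p (hj' p) hdim _
    obtain ⟨β, Dβ, hβmax, h0β, -, -, -, hβagree⟩ :=
      exists_isMaximalGeodesicOn_lift (g := (Kerr.smoothMetric M a M).toPseudoRiemannianMetric)
        (g' := 𝒦.metric.toPseudoRiemannianMetric) hj1 hj' hdim hiso.2 (hKmax.comp_add b) h0b hq hw
    refine ⟨β, Dβ, hβmax.isOpen, hβmax.2.1, h0β, hβmax.isGeodesicOn, fun u hu ↦ ?_⟩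
    rw [hβagree u hu]
    show γK (u - (-b)) = γK (u + b)
    rw [sub_neg_eq_add]
  -- conclusion: completeness ascends, sojourn sets ascend
  rcases hR₁ y hyR₁ γK domK hrayK with hK | hK
  · refine Or.inl fun hb ↦ ?_
    obtain ⟨B, hB⟩ := hb
    have h1 : max B 0 + 1 ∈ dom :=
      hcover _ (hK (show (0 : ℝ) ≤ max B 0 + 1 by positivity)) (by positivity)
    have h2 := hB h1
    linarith [le_max_left B 0]
  · refine Or.inr (hK.trans (MeasureTheory.measure_mono fun t ht ↦ ?_))
    obtain ⟨htK, ht0, hJ⟩ := ht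
    have htd : t ∈ dom := hcover t htK ht0
    refine ⟨htd, ht0, ?_⟩
    have hjt : j (γ t) = γK t := hagree t htd
    -- `J⁺_chart(sliceEmbed S) ∩ range j` pulls back to `J⁺_𝒦(ι_𝒦 S)`: connecting causal curves from the
    -- flat leaf stay in `{t* ≥ 0}` (the clock `t*`), inside `range j`
    generalize {y' : Kerr.slice a M | 8 * M ≤ ‖(y' : E3)‖ ∧ ‖(y' : E3)‖ ≤ 10 * M} = S at hJ ⊢
    have hS : Kerr.sliceEmbed a M '' S = j '' (𝒦.embed '' S) := by rw [← image_comp, hjι]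
    rw [hS] at hJ
    have hstay : ∀ (c : ℝ → Kerr.region a M) (a' b' : ℝ), a' < b' →
        (Kerr.smoothMetric M a M).IsFutureCausalCurveOn
          ((Kerr.timeOrientation M a M hM.le).ofLE le_top) c (Icc a' b') →
        c a' ∈ j '' (𝒦.embed '' S) → ∀ σ ∈ Icc a' b', c σ ∈ range j := by
      rintro c a' b' hab hc ⟨x, ⟨y', -, rfl⟩, hca⟩ σ hσ
      have hu0 : 0 ≤ (c a' : E4) 0 := by
        rw [← hca, show j (𝒦.embed y') = Kerr.sliceEmbed a M y' from congrFun hjι y',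
          Kerr.coe_sliceEmbed, E4.ofTimeSpace_apply_zero]
      exact hW (KerrSlabTransfer.time_nonneg_of_le ordConnected_Icc hc (left_mem_Icc.2 hab.le) hu0 hσ
        hσ.1)
    have h := LorentzianMetric.invFun_mem_causalFuture hiso hτ hjinj hloc hstay hJ ⟨γ t, hjt⟩
    rwa [← hjt, Function.leftInverse_invFun hjinj] at h

end Summit.FinalStateConjecture.FinalStateConjecture.Theorems.NearExtremalKappaCapture.UnitTemperatureFrontFace

end
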